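import Summits.BirchSwinnertonDyer.BirchSwinnertonDyer.Theorems.GenusKolyvaginAtTwoShaCardDvdPowAtTwoPosTSharpExponentRatOfNonPhantomOfRegularPairSupply
import Summits.BirchSwinnertonDyer.BirchSwinnertonDyer.Theorems.GenusKolyvaginAtTwoShaCardDvdPowAtTwoPosTSharpExponentRatOfRegularPairSupplyCorollaries
import Summits.BirchSwinnertonDyer.BirchSwinnertonDyer.Theorems.GenusKolyvaginAtTwoShaCardDvdPowAtTwoPosTRegularSignedPairChebotarev
import Literature.NumberTheory.Automorphic.TunnellLemma
import HarnessLib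

/-!
# Route `GenusKolyvaginAtTwo`, crux U⁺_T `ShaCardDvdPowAtTwoPosT` (stmt-BirchSwinnertonDyer-23378), LEAD gk2-p1 g20's LINE
# `rational_pair_descent_pos`, STUB `stub_b2qSignFree` — KOLYVAGIN'S THEOREM B₂ AT `l = 2` OVER `ℚ`, SHARP, SIGN-FREE:
# `2^{M₀} · Sel_(2^M)(E/ℚ) = 0` on the habitat for EITHER sign of `Δ(E)`, modulo Q2 only

Seat `bsd-line-gk2-p5` g31 (WIDTH-5 attach, cell `bsd-f1-sign2`), `--supports stmt-BirchSwinnertonDyer-23378` (registered stub `stub_b2qSignFree` of the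
LEAD's skeleton, 2026-08-30T01:19:56Z).  THEOREMS ONLY (no definition, no named fact, no `sorry`).  BSD is NOT proved by any of this; U⁺_T is
NOT proved (the LINE's other stubs `stub_onCutPos`, `stub_residualOffCutPos`, `stub_kolyvaginRelationAtTwo` remain); nothing is closed.

ASSEMBLY of three landed pieces:
* the B2Q± FRAME `PlusDescent.two_pow_smul_selmer_rat_eq_zero_of_regularPairSupply` (this seat, p754192): g22's B2Q with `Δ < 0` deleted, modulo the
  displayed regular signed pair-Čebotarev supply `hPair` (archimedean bit: `…PosTArchimedeanMarginOne`, p752988; regular local consumers: sibling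
  23716 engine);
* the REGULAR SIGNED PAIR-ČEBOTAREV `RegularSigned.exists_regular_kolyvaginPrime_fullOrder_signedPair_of_heegner` (gk2-p4 g23, p754753: for a
  separated `c`-eigenpair of signs `±1` a regular Kolyvagin prime of index `≥ n+1` with FULL local orders — signed Step B at a regular element,
  the sibling's end-to-end regular Čebotarev, the socle split), modulo the tree theorem `Automorphic.chebotarev_artinRep_of_galoisSide`;
* the adapters of `…OfRegularPairSupplyCorollaries` (p754752).

WHAT.
* `regularPairSupply_of_heegner` — **`hPair` HOLDS on the whole frame** (`E/ℚ` globally minimal, `ρ_{E,2^n}` onto for all `n`; `K` imaginary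
  quadratic, `d_K` odd, Heegner for `N_E`) — ANY sign of `Δ`: g23's theorem + the dictionary (involution ⟸ `h = c₀·res ρ` and `(c₀·res ρ)² = 1`;
  moved `2`-torsion point ⟸ the lossless witness; `n+1 ≤ kolyvaginIndex` ⟸ `Zhang2014.le_kolyvaginIndex_iff`).
* **`stub_b2qSignFree`** — the LEAD's registered signature VERBATIM (= g22's `two_pow_smul_selmer_rat_eq_zero_onHabitat` with `hneg` deleted):
  `2^{M₀} • s = 0` for every `s ∈ Sel_(2^M)(E/ℚ)`, every `M`, on U_T's frame WITHOUT any sign condition on `Δ(E)` — SHARP (no archimedean bit lost).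
* `two_pow_smul_selmer_rat_eq_zero_of_nonPhantom` / `two_pow_M0_smul_eq_zero_of_mem_sha_rat_of_nonPhantom` — the MASTER form with `hPair`
  discharged: B2Q on the WHOLE habitat modulo Q2 and (NPh_K) only (no `Δ` sign, no multiplicative prime, no side conditions).
* `two_pow_M0_smul_eq_zero_of_mem_sha_rat_signFree` — `2^{M₀} · Ш(E/ℚ)[2^∞] = 0`, sign-free, on U_T's frame.

References: [Kolyvagin1989Izv] Thm. B₂, §3; [McCallumLMS1991] §3 Cor. 3.2, §4 Prop. 4.4, Lemma 4.6, §5 Lemma 5.3; [GrossLMS1991] §3 (3.1)–(3.3),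
Props. 5.4, 6.2, 8.2, §9, §10; [LawsonWuthrich2016] §7.1; [SerreGaloisCohomology1997] I §2.4.
-/

set_option autoImplicit false
-- the Theorems namespace of this sub repeats the summit name by design (D-0017 nested layout)
set_option linter.dupNamespace false

noncomputable section

open scoped Classical
open scoped AddSubgroup

namespace Summit.BirchSwinnertonDyer.BirchSwinnertonDyer.Theorems.GenusExact.PlusDescent

open WeierstrassCurve NumberField IsDedekindDomain Field Rat.HeightOneSpectrum Literature.NumberTheory.EllipticCurves
  Literature.NumberTheory.GaloisRepresentations Literature.NumberTheory.EllipticCurves.ModularForms AddSubgroup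
  Literature.NumberTheory.EllipticCurves.RingClassField
open Summit.BirchSwinnertonDyer.BirchSwinnertonDyer.Theses.GenusKolyvaginAtTwo (KolyvaginRelationAtTwo)
open Summit.BirchSwinnertonDyer.Rank1Residual
open Summit.BirchSwinnertonDyer.BirchSwinnertonDyer.Theorems.GenusExact

/-- **The regular signed pair-Čebotarev supply `hPair` HOLDS on the whole frame, ANY sign of `Δ(E)`**: `E/ℚ` globally minimal with `ρ_{E,2^n}`
onto for all `n ≥ 1`, `K` imaginary quadratic with odd `d_K` satisfying the Heegner hypothesis for `N_E`.  gk2-p4 g23's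
`RegularSigned.exists_regular_kolyvaginPrime_fullOrder_signedPair_of_heegner` (Čebotarev input = the tree theorem
`Automorphic.chebotarev_artinRep_of_galoisSide`) read through the adapters `smul_smul_eq_self_of_smul_eq`,
`exists_smul_ne_twoTorsion_of_regular_witness`, `Zhang2014.le_kolyvaginIndex_iff`. [cite: McCallumLMS1991, §3 Cor. 3.2] [cite: GrossLMS1991, §3, §9] -/
theorem regularPairSupply_of_heegner (W : WeierstrassCurve ℚ) [W.IsElliptic] [W.IsGloballyMinimal] [NeZero (W.conductorNorm ℤ)]
    (K : Type) [Field K] [NumberField K] (hIQ : IsImaginaryQuadratic K) (hodd : Odd (NumberField.discr K))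
    (hHe : SatisfiesHeegnerHypothesis (W.conductorNorm ℤ) K) (hρ : ∀ n : ℕ, 0 < n → W.HasSurjectiveModNGaloisRep ((2 : ℤ) ^ n)) :
    ∀ (n : ℕ) (c : K ≃ₐ[ℚ] K), c ≠ 1 →
      ∀ (x y : galH1Torsion (W.baseChange K) ((2 ^ (n + 1) : ℕ) : ℤ)) (ex ey : ℕ), 1 ≤ ex → 1 ≤ ey →
      addOrderOf x = 2 ^ ex → addOrderOf y = 2 ^ ey →
      ∀ (sx sy : ℤ), (sx = 1 ∨ sx = -1) → (sy = 1 ∨ sy = -1) →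
      conjAct W c ((2 ^ (n + 1) : ℕ) : ℤ) x = sx • x → conjAct W c ((2 ^ (n + 1) : ℕ) : ℤ) y = sy • y →
      (∀ a b : ℤ, (∀ ρ ∈ torsionFixing (W.baseChange K) ((2 ^ (n + 1) : ℕ) : ℤ),
          h1Eval (W.baseChange K) ((2 ^ (n + 1) : ℕ) : ℤ) (a • x + b • y) ρ = 0) → a • x + b • y = 0) →
      ∃ ℓ : ℕ, Zhang2014.IsKolyvaginPrime (W.conductorNorm ℤ) W K 2 ℓ ∧ n + 1 ≤ Zhang2014.kolyvaginIndex W 2 ℓ ∧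
        (∃ (v : HeightOneSpectrum (𝓞 ℚ)) (𝔓 : Ideal (absIntegers (𝓞 ℚ) ℚ)) (h c₀ : absoluteGaloisGroup ℚ),
          (ℓ : 𝓞 ℚ) ∈ v.asIdeal ∧ 𝔓 ∈ v.primesAbove ∧ IsArithFrobAt (𝓞 ℚ) h 𝔓 ∧ IsComplexConjugation (Rat.castHom ℝ) c₀ ∧
          (∀ X : geomTorsion W ((2 ^ (n + 1) : ℕ) : ℤ), h • h • X = X) ∧
          (∃ u : geomTorsion W ((2 : ℕ) : ℤ), h • u ≠ u) ∧
          ∀ (e : K →ₐ[ℚ] AlgebraicClosure ℚ) (z : K), h • e z = c₀ • e z) ∧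
        ∀ w : HeightOneSpectrum (𝓞 K), (ℓ : 𝓞 K) ∈ w.asIdeal →
          (∀ j : ℕ, ((2 ^ j : ℕ) : ℤ) • x ∈ (W.baseChange K).torsionLocalKer (w.adicCompletion K) ((2 ^ (n + 1) : ℕ) : ℤ) ↔ ex ≤ j) ∧
          (∀ j : ℕ, ((2 ^ j : ℕ) : ℤ) • y ∈ (W.baseChange K).torsionLocalKer (w.adicCompletion K) ((2 ^ (n + 1) : ℕ) : ℤ) ↔ ey ≤ j) := by
  intro n c hc x y ex ey hex hey hx hy sx sy hsx hsy hτx hτy hres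
  haveI : Fact (Nat.Prime 2) := ⟨Nat.prime_two⟩
  obtain ⟨c₀, hc₀⟩ := exists_isComplexConjugation (Rat.castHom ℝ)
  have hρ2 : W.HasSurjectiveModNGaloisRep 2 := by simpa using hρ 1 one_pos
  have hsurj : W.HasSurjectiveModNGaloisRep ((2 ^ (n + 1) : ℕ) : ℤ) := by
    have := hρ (n + 1) (Nat.succ_pos n); exact_mod_cast this
  obtain ⟨ρ, hsq, -, ⟨P, hPplus, -⟩, ℓ, -, hℓp, hℓN, hℓdK, hℓ2, hℓprime, ⟨v, 𝔓, h, hℓv, h𝔓, hh, hE, hKact⟩, hdvd1, hdvda, hloc⟩ :=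
    RegularSigned.exists_regular_kolyvaginPrime_fullOrder_signedPair_of_heegner (W := W) (N := W.conductorNorm ℤ)
      Literature.NumberTheory.Automorphic.chebotarev_artinRep_of_galoisSide hIQ hodd hHe n hρ2 hsurj hc₀ hc x y hex hey hx hy hsx hsy hτx
      hτy hres 0
  have hidx : n + 1 ≤ Zhang2014.kolyvaginIndex W 2 ℓ :=
    Zhang2014.le_kolyvaginIndex_iff.mpr ⟨hdvd1, by exact_mod_cast hdvda⟩
  exact ⟨ℓ, ⟨hℓp, hℓN, hℓdK, hℓ2, hℓprime, lt_of_lt_of_le (Nat.succ_pos n) hidx⟩, hidx,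
    ⟨v, 𝔓, h, c₀, hℓv, h𝔓, hh, hc₀, smul_smul_eq_self_of_smul_eq W hE hsq, exists_smul_ne_twoTorsion_of_regular_witness W hE ⟨P, hPplus⟩,
      hKact⟩, hloc⟩

/-- **STUB `stub_b2qSignFree` of the LEAD's LINE `rational_pair_descent_pos` on U⁺_T (stmt-BirchSwinnertonDyer-23378) — registered signature
VERBATIM: Kolyvagin's Theorem B₂ at `l = 2` over `ℚ`, SHARP (`2^{M₀} • s = 0` for every `s ∈ Sel_(2^M)(E/ℚ)`), on U_T's frame with NO sign
condition on `Δ(E)`** (non-CM, odd Tamagawa product, an odd multiplicative prime, `K` imaginary quadratic with `d_K` odd `≠ −3` Heegner and the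
two non-square side conditions, `ρ_{E,2^n}` onto, `d₁` with `2^{M₀+1} ∤ P(1)`, `w(E) = +1`; Q2 as antecedent) = the frame
`two_pow_smul_selmer_rat_eq_zero_of_regularPairSupply` fed with `regularPairSupply_of_heegner`.
[cite: Kolyvagin1989Izv, Thm. B₂, §3] [cite: McCallumLMS1991, §3 Cor. 3.2, §4 Prop. 4.4, §5 Lemma 5.3] [cite: GrossLMS1991, §10, Props. 5.4, 6.2, 8.2] -/
theorem stub_b2qSignFree : KolyvaginRelationAtTwo → ∀ (W : WeierstrassCurve ℚ) [W.IsElliptic] [W.IsGloballyMinimal] [NeZero (W.conductorNorm ℤ)], ¬ W.HasCM → Odd W.tamagawaProduct → ∀ (v : HeightOneSpectrum (𝓞 ℚ)), ((2 : ℕ) : 𝓞 ℚ) ∉ v.asIdeal → ((W.conductorNorm ℤ : ℕ) : 𝓞 ℚ) ∈ v.asIdeal → W.HasMultiplicativeReductionAt v → ∀ (K : Type) [Field K] [NumberField K], IsImaginaryQuadratic K → Odd (NumberField.discr K) → NumberField.discr K ≠ -3 → SatisfiesHeegnerHypothesis (W.conductorNorm ℤ) K → ¬ IsSquare ((NumberField.discr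 K : ℚ) * -|W.Δ|) → ¬ IsSquare ((NumberField.discr K : ℚ) * (-(2 * |W.Δ|))) → (∀ n : ℕ, 0 < n → W.HasSurjectiveModNGaloisRep ((2 : ℤ) ^ n)) → ∀ (Dt : ModularParametrizationData W (W.conductorNorm ℤ)) (β : ℤ) (ι : K →+* ℂ) (d₁ : KolyvaginHeegnerData Dt β ι 1) (M₀ : ℕ), (¬ ∃ Q : (W.baseChange (ringClassField K ι 1)).toAffine.Point, ((2 ^ (M₀ + 1) : ℕ) : ℤ) • Q = d₁.derivedPoint) → W.rootNumber = 1 → ∀ (M : ℕ) (s₀ : galH1Torsion W ((2 ^ M : ℕ) : ℤ)), s₀ ∈ selmerGroup W ((2 ^ M : ℕ) : ℤ) → ((2 ^ M₀ : ℕ) : ℤ) • s₀ = 0 := by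
  intro hQ2 W _ _ _ hcm hT v h2v hNv hmult K _ _ hIQ hodd h3 hHe hsq1 hsq2 hρ Dt β ι d₁ M₀ hndiv hw1 M s₀ hs₀
  exact two_pow_smul_selmer_rat_eq_zero_of_regularPairSupply hQ2 W hcm hT v h2v hNv hmult K hIQ hodd h3 hHe hsq1 hsq2 hρ Dt β ι d₁ M₀ hndiv hw1
    (regularPairSupply_of_heegner W K hIQ hodd hHe hρ) M s₀ hs₀

/-- **`2^{M₀} · Ш(E/ℚ)[2^∞] = 0`, SIGN-FREE**, on U_T's frame (non-CM, odd Tamagawa, odd multiplicative prime, `w(E) = +1`; Q2).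
[cite: Kolyvagin1989Izv, Thm. B₂] [cite: SilvermanAEC2009, Thm. X.4.2(a)] -/
theorem two_pow_M0_smul_eq_zero_of_mem_sha_rat_signFree (hQ2 : KolyvaginRelationAtTwo)
    (W : WeierstrassCurve ℚ) [W.IsElliptic] [W.IsGloballyMinimal] [NeZero (W.conductorNorm ℤ)] (hcm : ¬ W.HasCM)
    (hT : Odd W.tamagawaProduct) (v : HeightOneSpectrum (𝓞 ℚ)) (h2v : ((2 : ℕ) : 𝓞 ℚ) ∉ v.asIdeal)
    (hNv : ((W.conductorNorm ℤ : ℕ) : 𝓞 ℚ) ∈ v.asIdeal) (hmult : W.HasMultiplicativeReductionAt v)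
    (K : Type) [Field K] [NumberField K] (hIQ : IsImaginaryQuadratic K) (hodd : Odd (NumberField.discr K))
    (h3 : NumberField.discr K ≠ -3) (hHe : SatisfiesHeegnerHypothesis (W.conductorNorm ℤ) K)
    (hsq1 : ¬ IsSquare ((NumberField.discr K : ℚ) * -|W.Δ|)) (hsq2 : ¬ IsSquare ((NumberField.discr K : ℚ) * (-(2 * |W.Δ|))))
    (hρ : ∀ n : ℕ, 0 < n → W.HasSurjectiveModNGaloisRep ((2 : ℤ) ^ n))
    (Dt : ModularParametrizationData W (W.conductorNorm ℤ)) (β : ℤ) (ι : K →+* ℂ) (d₁ : KolyvaginHeegnerData Dt β ι 1) (M₀ : ℕ)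
    (hndiv : ¬ ∃ Q : (W.baseChange (ringClassField K ι 1)).toAffine.Point, ((2 ^ (M₀ + 1) : ℕ) : ℤ) • Q = d₁.derivedPoint)
    (hw1 : W.rootNumber = 1)
    (k : ℕ) (a : W.galH1) (ha : a ∈ W.sha) (hka : ((2 ^ k : ℕ) : ℤ) • a = 0) :
    ((2 ^ M₀ : ℕ) : ℤ) • a = 0 :=
  two_pow_M0_smul_eq_zero_of_mem_sha_rat_of_regularPairSupply hQ2 W hcm hT v h2v hNv hmult K hIQ hodd h3 hHe hsq1 hsq2 hρ Dt β ι d₁ M₀ hndiv hw1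
    (regularPairSupply_of_heegner W K hIQ hodd hHe hρ) k a ha hka

/-- **B2Q on the WHOLE habitat modulo Q2 and (NPh_K) only** (the MASTER form `two_pow_smul_selmer_rat_eq_zero_of_nonPhantom_of_regularPairSupply`
with `hPair` discharged by `regularPairSupply_of_heegner`): non-CM, odd Tamagawa product, `ρ_{E,2^n}` onto; `K` imaginary quadratic, `d_K` odd `≠ −3`,
Heegner; `d₁` with `2^{M₀+1} ∤ P(1)`; `w(E) = +1`; (NPh_K) — NO sign of `Δ`, NO multiplicative prime, NO non-square side condition ⟹
`2^{M₀} • s = 0` for every `s ∈ Sel_(2^M)(E/ℚ)`.  gk2-p4 g23's `…_of_nonPhantom_onHabitat` (p753104) is its `Δ < 0` instance.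
[cite: Kolyvagin1989Izv, Thm. B₂, §3] [cite: McCallumLMS1991, §5 Lemma 5.3] [cite: LawsonWuthrich2016, §7.1] -/
theorem two_pow_smul_selmer_rat_eq_zero_of_nonPhantom (hQ2 : KolyvaginRelationAtTwo)
    (W : WeierstrassCurve ℚ) [W.IsElliptic] [W.IsGloballyMinimal] [NeZero (W.conductorNorm ℤ)] (hcm : ¬ W.HasCM)
    (hT : Odd W.tamagawaProduct)
    (K : Type) [Field K] [NumberField K] (hIQ : IsImaginaryQuadratic K) (hodd : Odd (NumberField.discr K))
    (h3 : NumberField.discr K ≠ -3) (hHe : SatisfiesHeegnerHypothesis (W.conductorNorm ℤ) K)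
    (hρ : ∀ n : ℕ, 0 < n → W.HasSurjectiveModNGaloisRep ((2 : ℤ) ^ n))
    (hNPh : ∀ (L : ℕ), 1 ≤ L → ∀ z : galH1Torsion (W.baseChange K) ((2 ^ L : ℕ) : ℤ),
      (∀ ρ' ∈ torsionFixing (W.baseChange K) ((2 ^ L : ℕ) : ℤ), h1Eval (W.baseChange K) ((2 ^ L : ℕ) : ℤ) z ρ' = 0) →
      (∀ w : HeightOneSpectrum (𝓞 K), z ∈ selmerLocalKer (W.baseChange K) (w.adicCompletion K) ((2 ^ L : ℕ) : ℤ)) → z = 0)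
    (Dt : ModularParametrizationData W (W.conductorNorm ℤ)) (β : ℤ) (ι : K →+* ℂ) (d₁ : KolyvaginHeegnerData Dt β ι 1) (M₀ : ℕ)
    (hndiv : ¬ ∃ Q : (W.baseChange (ringClassField K ι 1)).toAffine.Point, ((2 ^ (M₀ + 1) : ℕ) : ℤ) • Q = d₁.derivedPoint)
    (hw1 : W.rootNumber = 1)
    (M : ℕ) (s₀ : galH1Torsion W ((2 ^ M : ℕ) : ℤ)) (hs₀ : s₀ ∈ selmerGroup W ((2 ^ M : ℕ) : ℤ)) :
    ((2 ^ M₀ : ℕ) : ℤ) • s₀ = 0 :=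
  two_pow_smul_selmer_rat_eq_zero_of_nonPhantom_of_regularPairSupply hQ2 W hcm hT K hIQ hodd h3 hHe hρ hNPh Dt β ι d₁ M₀ hndiv hw1
    (regularPairSupply_of_heegner W K hIQ hodd hHe hρ) M s₀ hs₀

/-- **`2^{M₀} · Ш(E/ℚ)[2^∞] = 0` on the whole habitat modulo Q2 and (NPh_K) only.** [cite: Kolyvagin1989Izv, Thm. B₂] [cite: SilvermanAEC2009, Thm. X.4.2(a)] -/
theorem two_pow_M0_smul_eq_zero_of_mem_sha_rat_of_nonPhantom (hQ2 : KolyvaginRelationAtTwo)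
    (W : WeierstrassCurve ℚ) [W.IsElliptic] [W.IsGloballyMinimal] [NeZero (W.conductorNorm ℤ)] (hcm : ¬ W.HasCM)
    (hT : Odd W.tamagawaProduct)
    (K : Type) [Field K] [NumberField K] (hIQ : IsImaginaryQuadratic K) (hodd : Odd (NumberField.discr K))
    (h3 : NumberField.discr K ≠ -3) (hHe : SatisfiesHeegnerHypothesis (W.conductorNorm ℤ) K)
    (hρ : ∀ n : ℕ, 0 < n → W.HasSurjectiveModNGaloisRep ((2 : ℤ) ^ n))
    (hNPh : ∀ (L : ℕ), 1 ≤ L → ∀ z : galH1Torsion (W.baseChange K) ((2 ^ L : ℕ) : ℤ),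
      (∀ ρ' ∈ torsionFixing (W.baseChange K) ((2 ^ L : ℕ) : ℤ), h1Eval (W.baseChange K) ((2 ^ L : ℕ) : ℤ) z ρ' = 0) →
      (∀ w : HeightOneSpectrum (𝓞 K), z ∈ selmerLocalKer (W.baseChange K) (w.adicCompletion K) ((2 ^ L : ℕ) : ℤ)) → z = 0)
    (Dt : ModularParametrizationData W (W.conductorNorm ℤ)) (β : ℤ) (ι : K →+* ℂ) (d₁ : KolyvaginHeegnerData Dt β ι 1) (M₀ : ℕ)
    (hndiv : ¬ ∃ Q : (W.baseChange (ringClassField K ι 1)).toAffine.Point, ((2 ^ (M₀ + 1) : ℕ) : ℤ) • Q = d₁.derivedPoint)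
    (hw1 : W.rootNumber = 1)
    (k : ℕ) (a : W.galH1) (ha : a ∈ W.sha) (hka : ((2 ^ k : ℕ) : ℤ) • a = 0) :
    ((2 ^ M₀ : ℕ) : ℤ) • a = 0 :=
  two_pow_M0_smul_eq_zero_of_mem_sha_rat_of_nonPhantom_of_regularPairSupply hQ2 W hcm hT K hIQ hodd h3 hHe hρ hNPh Dt β ι d₁ M₀ hndiv hw1
    (regularPairSupply_of_heegner W K hIQ hodd hHe hρ) k a ha hka

end Summit.BirchSwinnertonDyer.BirchSwinnertonDyer.Theorems.GenusExact.PlusDescent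

end
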